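import Mathlib
import Summits.ValiantsHypothesis.ValiantsHypothesis.Theorems.BarrierLeverPartitionMinorsHitByVPHiddenStatesPairBlockMatrix

/-!
# Route BarrierLever — item `PartitionMinorsHitByVP` (stmt-ValiantsHypothesis-19717), line `hidden_states`:
# LOW-DEGREE FREENESS — against a pair block with enough states, the rows of size `≤ s` carry NO circuit

Helper file (`--supports stmt-ValiantsHypothesis-19717`; cell valiant-natproofs, rung V4, 𝒟-side door (c), line `hidden_states`, node #1;
prover seat val-np-p3 gen 21; memo HOME/val-np-p3/g21/MEMO-bpwindow-valnp3-g21.md §S «Lemma F_s»). Definition-light. Closes NO item.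

THE POSITIVE COUNTERPART OF THE LAWS. Every law of the line (ShadowRank, shared quadric p725561, vertex cover p726122) is a CIRCUIT of
the generic row matroid of a design: a dependent family of rows. Here is the first explicit circuit-FREE region for a pair block:
if a multilinear polynomial `f = Σ_{|U| ≤ s} c_U x^U` vanishes at the indicator points `1_{V'}` (`|V'| ≤ s−1`) and at the points
`e_a + 1_{V'}` (`spt`), then `f = 0` (`coeff_eq_zero_of_vanishing`). Mechanism: `f(e_a + y) − f(y) = Σ_{U ∌ a} c_{U ∪ a} y^U` has degree `≤ s−1`
and vanishes on the points `1_{V'}`, which are unisolvent for multilinear polynomials of degree `≤ s−1` (Möbius induction on `|V'|`).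
These points and sums are singles and cross pairs of the complete pair block on the `h + Σ_{j ≤ s−1} C(h,j)` states
`{e_a} ∪ {1_{V'}}`, so (`lowRows_independent`): **for that table the rows of size `≤ s` are linearly independent against the complete
pair block** — hence for a generic table too (rank is lower semicontinuous), and for every pair block with at least that many states.
For the design of record (`b ≥ h²/4 … h³/8` states per piece) and `s = 3` (`b ≥ h + 1 + h + C(h,2)`): every piece is circuit-free in
degrees `≤ 3`; the first circuits of the design's row matroid involve rows of size `≥ 4`, where no known law bites inside `Fin h` for
`h ≤ 105` (memo §13). WHAT THIS IS NOT: no statement about rows of size `≥ s+1`; nothing on crux 14610 or VP ≠ VNP.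
-/

set_option linter.dupNamespace false

namespace Summit.ValiantsHypothesis.ValiantsHypothesis.Theorems.BarrierLever.HiddenStates

open Finset

noncomputable section

namespace LowDegreeFree

variable {h : ℕ}

/-- The multilinear form with coefficients `c` on the sets of size `≤ s`, evaluated at `z`. -/
def evalML (s : ℕ) (c : Finset (Fin h) → ℂ) (z : Fin h → ℂ) : ℂ :=
  ∑ U ∈ (Finset.univ : Finset (Finset (Fin h))).filter (fun U => U.card ≤ s), c U * ∏ x ∈ U, z x

/-- The indicator vector of a set. -/
def ind (V : Finset (Fin h)) : Fin h → ℂ := fun x => if x ∈ V then 1 else 0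

/-- The point `e_a + 1_V`. -/
def spt (a : Fin h) (V : Finset (Fin h)) : Fin h → ℂ := fun x => (if x = a then 1 else 0) + ind V x

/-- `∏_{x ∈ U} 1_V(x) = [U ⊆ V]`. -/
theorem prod_ind (U V : Finset (Fin h)) : ∏ x ∈ U, ind V x = if U ⊆ V then 1 else 0 := by
  classical
  by_cases hUV : U ⊆ V
  · rw [if_pos hUV]
    exact Finset.prod_eq_one fun x hx => by simp [ind, hUV hx]
  · rw [if_neg hUV]
    obtain ⟨x, hxU, hxV⟩ := Finset.not_subset.mp hUV
    exact Finset.prod_eq_zero hxU (by simp [ind, hxV])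

/-- Evaluation at an indicator point: `f(1_V) = Σ_{U ⊆ V, |U| ≤ s} c_U`. -/
theorem evalML_ind (s : ℕ) (c : Finset (Fin h) → ℂ) (V : Finset (Fin h)) :
    evalML s c (ind V) = ∑ U ∈ V.powerset.filter (fun U => U.card ≤ s), c U := by
  classical
  simp only [evalML, prod_ind, mul_ite, mul_one, mul_zero]
  rw [Finset.sum_ite, Finset.sum_const_zero, add_zero]
  refine Finset.sum_congr ?_ fun _ _ => rfl
  ext U
  simp [Finset.mem_filter, and_comm]

/-- **Unisolvence of the small indicator points (Möbius induction).** A multilinear form of degree `≤ t` vanishing at every `1_V`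
with `|V| ≤ t` is zero. -/
theorem coeff_eq_zero_of_vanishing_ind (t : ℕ) (d : Finset (Fin h) → ℂ)
    (hd : ∀ V : Finset (Fin h), V.card ≤ t → evalML t d (ind V) = 0) :
    ∀ U : Finset (Fin h), U.card ≤ t → d U = 0 := by
  classical
  intro U
  induction U using Finset.strongInduction with
  | H U ih =>
    intro hU
    have hev := hd U hU
    rw [evalML_ind] at hev
    -- split off the term `U` itself; the proper subsets vanish by induction
    have hmem : U ∈ U.powerset.filter (fun U' => U'.card ≤ t) := by
      rw [Finset.mem_filter, Finset.mem_powerset]; exact ⟨subset_rfl, hU⟩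
    rw [← Finset.add_sum_erase _ _ hmem] at hev
    have hrest : ∑ U' ∈ (U.powerset.filter (fun U' => U'.card ≤ t)).erase U, d U' = 0 := by
      refine Finset.sum_eq_zero fun U' hU' => ?_
      rw [Finset.mem_erase, Finset.mem_filter, Finset.mem_powerset] at hU'
      exact ih U' (lt_of_le_of_ne hU'.2.1 hU'.1) hU'.2.2
    rw [hrest, add_zero] at hev
    exact hev

/-- The difference `f(e_a + y) − f(y)` at `y = 1_V`: it equals the degree-`(s−1)` form with coefficients `U ↦ c (insert a U)`
(on the sets not containing `a`) evaluated at `1_V`. -/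
theorem evalML_spt_sub (s : ℕ) (hs : 1 ≤ s) (c : Finset (Fin h) → ℂ) (a : Fin h) (V : Finset (Fin h)) :
    evalML s c (spt a V) - evalML s c (ind V) =
      evalML (s - 1) (fun U => if a ∈ U then 0 else c (insert a U)) (ind V) := by
  classical
  -- expand both sides over all sets; regroup the left side by `U ↦ U.erase a`
  have hL : ∀ U : Finset (Fin h), (∏ x ∈ U, spt a V x) - ∏ x ∈ U, ind V x =
      if a ∈ U then ∏ x ∈ U.erase a, ind V x else 0 := by
    intro U
    by_cases haU : a ∈ U
    · rw [if_pos haU, ← Finset.mul_prod_erase U _ haU, ← Finset.mul_prod_erase U (ind V) haU]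
      have hsame : ∏ x ∈ U.erase a, spt a V x = ∏ x ∈ U.erase a, ind V x :=
        Finset.prod_congr rfl fun x hx => by
          have hxa : x ≠ a := Finset.ne_of_mem_erase hx
          simp [spt, hxa]
      rw [hsame]
      simp only [spt, if_true]
      ring
    · rw [if_neg haU]
      have hsame : ∏ x ∈ U, spt a V x = ∏ x ∈ U, ind V x :=
        Finset.prod_congr rfl fun x hx => by
          have hxa : x ≠ a := fun hxa => haU (hxa ▸ hx)
          simp [spt, hxa]
      rw [hsame, sub_self]
  have hlhs : evalML s c (spt a V) - evalML s c (ind V) =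
      ∑ U ∈ ((Finset.univ : Finset (Finset (Fin h))).filter (fun U => U.card ≤ s)).filter (fun U => a ∈ U),
        c U * ∏ x ∈ U.erase a, ind V x := by
    unfold evalML
    rw [← Finset.sum_sub_distrib, Finset.sum_filter (p := fun U => a ∈ U)]
    refine Finset.sum_congr rfl fun U _ => ?_
    rw [← mul_sub, hL]
    split_ifs <;> simp
  have hrhs : evalML (s - 1) (fun U => if a ∈ U then 0 else c (insert a U)) (ind V) =
      ∑ U ∈ ((Finset.univ : Finset (Finset (Fin h))).filter (fun U => U.card ≤ s - 1)).filter (fun U => a ∉ U),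
        c (insert a U) * ∏ x ∈ U, ind V x := by
    unfold evalML
    rw [Finset.sum_filter (p := fun U => a ∉ U)]
    refine Finset.sum_congr rfl fun U _ => ?_
    by_cases haU : a ∈ U <;> simp [haU]
  rw [hlhs, hrhs]
  symm
  refine Finset.sum_bij' (fun U _ => insert a U) (fun U _ => U.erase a) ?_ ?_ ?_ ?_ ?_
  · intro U hU
    simp only [Finset.mem_filter, Finset.mem_univ, true_and] at hU ⊢
    refine ⟨?_, Finset.mem_insert_self a U⟩
    rw [Finset.card_insert_of_notMem hU.2]; omega
  · intro U hU
    simp only [Finset.mem_filter, Finset.mem_univ, true_and] at hU ⊢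
    refine ⟨?_, Finset.notMem_erase a U⟩
    rw [Finset.card_erase_of_mem hU.2]; omega
  · intro U hU
    simp only [Finset.mem_filter, Finset.mem_univ, true_and] at hU
    exact Finset.erase_insert hU.2
  · intro U hU
    simp only [Finset.mem_filter, Finset.mem_univ, true_and] at hU
    exact Finset.insert_erase hU.2
  · intro U hU
    simp only [Finset.mem_filter, Finset.mem_univ, true_and] at hU
    rw [Finset.erase_insert hU.2]

/-- **LOW-DEGREE FREENESS (polynomial form).** If `f = Σ_{|U| ≤ s} c_U x^U` (`s ≥ 1`) vanishes at every indicator point `1_V` with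
`|V| ≤ s − 1` and at every point `e_a + 1_V` (`|V| ≤ s − 1`), then all its coefficients vanish. -/
theorem coeff_eq_zero_of_vanishing (s : ℕ) (hs : 1 ≤ s) (c : Finset (Fin h) → ℂ)
    (hV : ∀ V : Finset (Fin h), V.card ≤ s - 1 → evalML s c (ind V) = 0)
    (haV : ∀ (a : Fin h) (V : Finset (Fin h)), V.card ≤ s - 1 → evalML s c (spt a V) = 0) :
    ∀ U : Finset (Fin h), U.card ≤ s → c U = 0 := by
  classical
  -- the coefficients `c (insert a U')`, `a ∉ U'`, `|U'| ≤ s-1`, vanish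
  have hins : ∀ (a : Fin h) (U' : Finset (Fin h)), U'.card ≤ s - 1 → a ∉ U' → c (insert a U') = 0 := by
    intro a U' hU' haU'
    have hd := coeff_eq_zero_of_vanishing_ind (s - 1) (fun U => if a ∈ U then 0 else c (insert a U)) (fun V hVc => by
      rw [← evalML_spt_sub s hs c a V, haV a V hVc, hV V hVc, sub_zero]) U' hU'
    simpa [haU'] using hd
  intro U hU
  rcases Finset.eq_empty_or_nonempty U with rfl | ⟨a, haU⟩
  · -- the constant coefficient: evaluate at `1_∅ = 0`
    have h0 := hV ∅ (by simp)
    rw [evalML_ind] at h0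
    simpa [Finset.powerset_empty, Finset.filter_singleton] using h0
  · have hU' : (U.erase a).card ≤ s - 1 := by rw [Finset.card_erase_of_mem haU]; omega
    have := hins a (U.erase a) hU' (Finset.notMem_erase a U)
    rwa [Finset.insert_erase haU] at this

/-- **LOW ROWS ARE INDEPENDENT against any point set containing the indicator points `1_V` (`|V| ≤ s−1`) and the points
`e_a + 1_V`** — in particular against the complete pair block on the states `{e_a : a} ∪ {1_V : |V| ≤ s−1}` (singles `1_V`, cross pairs
`e_a + 1_V`), hence against every pair block with at least `h + Σ_{j<s} C(h,j)` states for a generic table: a vanishing combination of the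
rows `U ↦ (∏_{x∈U} P_i(x))_i`, `|U| ≤ s`, is trivial. -/
theorem lowRows_independent {ι : Type*} (P : ι → Fin h → ℂ) (s : ℕ) (hs : 1 ≤ s)
    (hind : ∀ V : Finset (Fin h), V.card ≤ s - 1 → ∃ i, P i = ind V)
    (hspt : ∀ (a : Fin h) (V : Finset (Fin h)), V.card ≤ s - 1 → ∃ i, P i = spt a V)
    (c : Finset (Fin h) → ℂ) (hc : ∀ i, evalML s c (P i) = 0) :
    ∀ U : Finset (Fin h), U.card ≤ s → c U = 0 :=
  coeff_eq_zero_of_vanishing s hs c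
    (fun V hV => by obtain ⟨i, hi⟩ := hind V hV; rw [← hi]; exact hc i)
    (fun a V hV => by obtain ⟨i, hi⟩ := hspt a V hV; rw [← hi]; exact hc i)

/-- The pair column of the states `e_a` and `1_V` of a zero-base piece IS the point `spt a V = e_a + 1_V`
(so `lowRows_independent` applies to the complete pair block on the states `{e_a} ∪ {1_V}`). -/
theorem spt_eq_add (a : Fin h) (V : Finset (Fin h)) :
    spt a V = (fun x => (if x = a then (1 : ℂ) else 0)) + ind V := by
  funext x; simp [spt]

end LowDegreeFree

end

end Summit.ValiantsHypothesis.ValiantsHypothesis.Theorems.BarrierLever.HiddenStates
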